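import Literature.NumberTheory.Rogawski1990.FinExplicitTransferFactorSplitPlace   -- ★ D-S2 (p835818): `finWeylRatio_eq_box_of_split` (the box `u_w⁻¹ • g_w` on `L_w²`)
import Literature.NumberTheory.Automorphic.ParabolicGL                            -- ★ `standardParabolicGL`, `leviEmbeddingP`, `blockDiagonalGL_apply_coe`, `standardLeviGL`
import Mathlib.LinearAlgebra.Matrix.Kronecker
import HarnessLib

/-!
# The box of `Ad(p)` for a LEVI element `p = diag(m_I, m_J)` of a two-block parabolic of `GL_n` IS `m_I ⊗ (m_J⁻¹)ᵀ`; for a block of size one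
# it is `m_J⁻¹ • m_I` — the identification of the D-S1 box `Matrix.of (p q.1 q′.1 * p⁻¹ q′.2 q.2)` with Rogawski's `K = u_w⁻¹ g_w` of D-S2

Topic `NumberTheory/Rogawski1990` (with a generic §1 in `Literature.NumberTheory.Automorphic`); THEOREMS ONLY (no definition, no named fact, no instance,
no notation, no `sorry`; net debt 0).  Cell `pub/hodgecm-mathlib`, F0∕P3a, topic T6, road letter «D-S2r — THE BOX REINDEXING» (LEAD F0P3a-plan (g7) T6-113 (2),
gap g3 of A-p13 (g28)'s «D-N7s» census), count-neutral under #88.  HC_CM is proved only modulo the printed citations until rung 0 closes; nothing printed is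
asserted here.

THE MATHEMATICS (one line).  Two presentations of the matrix of `Ad(p)` on the root box `𝔫` of a two-block parabolic `P_c ⊂ GL_n` (`c : n → Bool`,
`I = {c = false}`, `J = {c = true}`, `𝔫 ≅ R^{I × J}`) are in the tree: the D-S1 box (★ `GLnTwoBlockUnipotentConjugation.parabolic_conj_boxChart`,
★ `GLnTwoBlockBoxAdLIntegral`, ★ `GLnBlockScalarOrbitalIntegral.boxAd_leviEmbeddingP_scalar`)
`K_p := Matrix.of fun q q' : I × J => p q.1 q'.1 * p⁻¹ q'.2 q.2`, an `(I × J) × (I × J)` matrix for EVERY `p ∈ P_c`, and Rogawski's split-place box of ★ D-S2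
`FinExplicitTransferFactorSplitPlace.finWeylRatio_eq_box_of_split`, `K := u_w⁻¹ • g_w ∈ M₂(L_w)` for `γ_H = (g, u) ∈ U(Φ₂) × U(Φ₁)` read at the place `w`
(`D_{G∕H,v}(γ_H) = ‖det(1 − K)‖_w · ‖det K‖_w^{−1∕2}`).  For a LEVI element `p = leviEmbeddingP R c m = diag(m false, m true)` the block-diagonal entries give
`p q.1 q'.1 = (m false) q.1 q'.1` and `p⁻¹ q'.2 q.2 = (m true)⁻¹ q'.2 q.2`, i.e. **`K_p = (m false) ⊗ₖ ((m true)⁻¹)ᵀ`** (`Matrix.kronecker_apply`); when the second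
block is a single index `j₀` this reads `K_p (i,j₀) (i′,j₀) = ((m true)⁻¹)_{j₀j₀} · (m false)_{i i′}`, so under `q ↦ eI q.1` (any relabelling `eI : I ≃ ι` of the
first block) **`K_p` is `t⁻¹ • g`** with `g := reindex eI eI (m false)`, `t := (m true)_{j₀j₀}` — Rogawski's `u_w⁻¹ • g_w` on the nose when `(g, t) = (g_w, u_w)`, whence
the two `|D_{G∕M}|^{1∕2}` presentations `‖det(1 − K_p)‖ · ‖det K_p‖^{−1∕2}` and `finWeylRatio` are EQUAL.

* §1 (generic, any commutative ring, any `c : n → Bool`; ns `Literature.NumberTheory.Automorphic`): `blockDiagonalGL_apply_coe_of_block`,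
  `coe_leviEmbeddingP_inv`, **`boxAd_leviEmbeddingP_eq_kronecker`**, `reindex_boxAd_leviEmbeddingP` (two-block relabelling),
  (private plumbing: `(u⁻¹)_{j₀j₀} · u_{j₀j₀} = 1` on a one-element index type), **`boxAd_leviEmbeddingP_apply_of_forall_eq`** (entrywise, single second index),
  `submatrix_smul_reindex_eq_boxAd_of_forall_eq`, **`det_boxAd_leviEmbeddingP_of_forall_eq`**, **`det_one_sub_boxAd_leviEmbeddingP_of_forall_eq`**,
  `exists_eq_leviEmbeddingP_of_mem_standardLeviGL`.
* §2 (the split place; ns `Literature.NumberTheory.Rogawski1990`, D-S2's binders verbatim): **`finWeylRatio_eq_boxAd_of_split`**, `finWeylRatio_eq_of_split_of_scalar`.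

NOT here: the junction «`e(ξ_v γ_H) = leviEmbeddingP c′ m(g_w, u_w)`» through the endoscopic embedding and ★ `localSplitEquiv` (floor 2); §2 takes the block
data `(hg, ht)` as hypotheses, so any junction shape feeds it.

## References
* [Rogawski1990] J. D. Rogawski, *Automorphic Representations of Unitary Groups in Three Variables*, Ann. of Math. Stud. 123 (1990): §4.9 p. 55 (`D_{G∕H}`),
  §4.13 «The case of split primes» p. 64, Lemma 4.13.1 p. 64 and its proof pp. 64–66 (`P` of type `(2,1)`, the substitution on `N`, `|(1 − γ₂γ₁⁻¹)(1 − γ₂γ₃⁻¹)|_w`;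
  the sibling files' «p. 70» is the registered locator slip ROG-4131, lit1 (1054)∕(1100), lit2 (218)).
* [BernsteinZelevinsky1977] I. N. Bernstein, A. V. Zelevinsky, *Induced representations of reductive `p`-adic groups I*, Ann. Sci. ÉNS 10 (1977), §2.1
  (`P_β = M_β ⋉ U_β`), 1.7 (the module of `Ad`).
-/

set_option autoImplicit false

noncomputable section

open scoped MatrixGroups Kronecker
open Matrix

namespace Literature.NumberTheory.Automorphic

/-! ## §1 The box of `Ad(diag(m_I, m_J))` is `m_I ⊗ (m_J⁻¹)ᵀ` -/

section Generic

variable {R : Type*} [CommRing R] {n : Type*} [Fintype n] [DecidableEq n] {α : Type*} [LinearOrder α] [Fintype α] {c : n → α}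

/-- Entries of the block-diagonal matrix `diag(m_a)_a` at two indices of the SAME block `a`: `(m a)_{ij}`. [cite: BernsteinZelevinsky1977, §2.1] -/
theorem blockDiagonalGL_apply_coe_of_block (m : Π a, GL {i // c i = a} R) {a : α} (i j : {k // c k = a}) :
    ((blockDiagonalGL R c m : GL n R) : Matrix n n R) i j = ((m a : GL {k // c k = a} R) : Matrix {k // c k = a} {k // c k = a} R) i j := by
  rw [blockDiagonalGL_apply_coe]
  have hi : (⟨c (i : n), ⟨(i : n), rfl⟩⟩ : Σ b, {k // c k = b}) = ⟨a, i⟩ := Sigma.subtype_ext i.2 rfl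
  have hj : (⟨c (j : n), ⟨(j : n), rfl⟩⟩ : Σ b, {k // c k = b}) = ⟨a, j⟩ := Sigma.subtype_ext j.2 rfl
  rw [hi, hj, Matrix.blockDiagonal'_apply_eq]

/-- `(diag(m_a)_a)⁻¹ = diag(m_a⁻¹)_a` in `P_c`, read in `GL_n`. [cite: BernsteinZelevinsky1977, §2.1] -/
theorem coe_leviEmbeddingP_inv (m : Π a, GL {i // c i = a} R) :
    (((leviEmbeddingP R c m)⁻¹ : standardParabolicGL R c) : GL n R) = blockDiagonalGL R c m⁻¹ := by
  rw [← map_inv, coe_leviEmbeddingP]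

end Generic

section TwoBlock

variable {R : Type*} [CommRing R] {n : Type*} [Fintype n] [DecidableEq n] {c : n → Bool} (m : Π a, GL {i // c i = a} R)

/-- **THE BOX OF A LEVI ELEMENT IS A KRONECKER PRODUCT**: for `p = diag(m false, m true) ∈ P_c` the D-S1 box `K_p = Matrix.of (p q.1 q′.1 * p⁻¹ q′.2 q.2)` on
`I × J` is `(m false) ⊗ₖ ((m true)⁻¹)ᵀ` (`Ad(diag(A, B))` acts on `𝔫 = Hom(R^J, R^I)` by `X ↦ A X B⁻¹`). [cite: BernsteinZelevinsky1977, §2.1, 1.7]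
[cite: Rogawski1990, §4.13, proof of Lemma 4.13.1, pp. 64–66] -/
theorem boxAd_leviEmbeddingP_eq_kronecker :
    (Matrix.of fun q q' : {i : n // c i = false} × {j : n // c j = true} =>
        (((leviEmbeddingP R c m : standardParabolicGL R c) : GL n R) : Matrix n n R) q.1 q'.1 *
          ((((leviEmbeddingP R c m)⁻¹ : standardParabolicGL R c) : GL n R) : Matrix n n R) q'.2 q.2) =
      ((m false : GL {i : n // c i = false} R) : Matrix {i : n // c i = false} {i : n // c i = false} R) ⊗ₖ
        ((((m true)⁻¹ : GL {j : n // c j = true} R) : Matrix {j : n // c j = true} {j : n // c j = true} R))ᵀ := by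
  ext ⟨i, j⟩ ⟨i', j'⟩
  rw [Matrix.of_apply, Matrix.kronecker_apply, Matrix.transpose_apply, coe_leviEmbeddingP, coe_leviEmbeddingP_inv,
    blockDiagonalGL_apply_coe_of_block, blockDiagonalGL_apply_coe_of_block, Pi.inv_apply]

/-- **Two-block relabelling**: along `eI : I ≃ ι₁`, `eJ : J ≃ ι₂` the box of `diag(m false, m true)` is `reindex eI eI (m false) ⊗ₖ (reindex eJ eJ (m true)⁻¹)ᵀ`.
[cite: BernsteinZelevinsky1977, §2.1, 1.7] -/
theorem reindex_boxAd_leviEmbeddingP {ι₁ ι₂ : Type*} (eI : {i : n // c i = false} ≃ ι₁) (eJ : {j : n // c j = true} ≃ ι₂) :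
    Matrix.reindex (eI.prodCongr eJ) (eI.prodCongr eJ)
        (Matrix.of fun q q' : {i : n // c i = false} × {j : n // c j = true} =>
          (((leviEmbeddingP R c m : standardParabolicGL R c) : GL n R) : Matrix n n R) q.1 q'.1 *
            ((((leviEmbeddingP R c m)⁻¹ : standardParabolicGL R c) : GL n R) : Matrix n n R) q'.2 q.2) =
      Matrix.reindex eI eI ((m false : GL {i : n // c i = false} R) : Matrix {i : n // c i = false} {i : n // c i = false} R) ⊗ₖ
        (Matrix.reindex eJ eJ ((((m true)⁻¹ : GL {j : n // c j = true} R) : Matrix {j : n // c j = true} {j : n // c j = true} R)))ᵀ := by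
  rw [boxAd_leviEmbeddingP_eq_kronecker]
  ext ⟨i, j⟩ ⟨i', j'⟩
  rfl

/-- For an invertible matrix on a ONE-element index type `{j₀}`: `(u⁻¹)_{j₀j₀} · u_{j₀j₀} = 1`. [folklore] -/
private theorem GeneralLinearGroup.inv_apply_mul_apply_of_forall_eq {J : Type*} [Fintype J] [DecidableEq J] (u : GL J R) (j₀ : J) (hj₀ : ∀ j : J, j = j₀) :
    ((u⁻¹ : GL J R) : Matrix J J R) j₀ j₀ * (u : Matrix J J R) j₀ j₀ = 1 := by
  have h := congr_fun (congr_fun (Units.inv_mul u) j₀) j₀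
  rw [Matrix.mul_apply, Matrix.one_apply_eq, Finset.sum_eq_single j₀ (fun j _ hj => absurd (hj₀ j) hj) (fun h => absurd (Finset.mem_univ _) h)] at h
  exact h

/-- Field form: `(u⁻¹)_{j₀j₀} = (u_{j₀j₀})⁻¹` on a one-element index type. [folklore] -/
private theorem GeneralLinearGroup.inv_apply_of_forall_eq {K : Type*} [Field K] {J : Type*} [Fintype J] [DecidableEq J] (u : GL J K) (j₀ : J)
    (hj₀ : ∀ j : J, j = j₀) : ((u⁻¹ : GL J K) : Matrix J J K) j₀ j₀ = ((u : Matrix J J K) j₀ j₀)⁻¹ :=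
  eq_inv_of_mul_eq_one_left (GeneralLinearGroup.inv_apply_mul_apply_of_forall_eq u j₀ hj₀)

variable (j₀ : {j : n // c j = true}) (hj₀ : ∀ j : {j : n // c j = true}, j = j₀)

include hj₀ in
/-- **ENTRYWISE AGREEMENT (single second index)**: when `J = {j₀}` (a maximal parabolic of type `(|I|, 1)`; token shape of ★ `det_one_sub_boxAd_eq_of_forall_eq`),
`K_p (q) (q′) = ((m true)⁻¹)_{j₀j₀} · (m false)_{q.1 q′.1}` for `p = diag(m false, m true)` — the box is the homothety `(m true)⁻¹_{j₀j₀}` times the first block, read on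
the first coordinates; no equivalence is needed. [cite: Rogawski1990, §4.13, proof of Lemma 4.13.1, pp. 64–66] -/
theorem boxAd_leviEmbeddingP_apply_of_forall_eq (q q' : {i : n // c i = false} × {j : n // c j = true}) :
    (Matrix.of fun q q' : {i : n // c i = false} × {j : n // c j = true} =>
        (((leviEmbeddingP R c m : standardParabolicGL R c) : GL n R) : Matrix n n R) q.1 q'.1 *
          ((((leviEmbeddingP R c m)⁻¹ : standardParabolicGL R c) : GL n R) : Matrix n n R) q'.2 q.2) q q' =
      ((((m true)⁻¹ : GL {j : n // c j = true} R) : Matrix {j : n // c j = true} {j : n // c j = true} R) j₀ j₀) *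
        ((m false : GL {i : n // c i = false} R) : Matrix {i : n // c i = false} {i : n // c i = false} R) q.1 q'.1 := by
  rw [boxAd_leviEmbeddingP_eq_kronecker]
  obtain ⟨i, j⟩ := q
  obtain ⟨i', j'⟩ := q'
  rw [Matrix.kronecker_apply, Matrix.transpose_apply, hj₀ j, hj₀ j', mul_comm]

include hj₀ in
/-- **THE TWO BOXES AGREE under `q ↦ eI q.1`**: for any relabelling `eI : I ≃ ι` of the first block, the pull-back of `((m true)⁻¹)_{j₀j₀} • reindex eI eI (m false)`
(Rogawski's `t⁻¹ • g` on `R^ι`) along `I × {j₀} → ι`, `q ↦ eI q.1`, IS the D-S1 box of `diag(m false, m true)`. [cite: Rogawski1990, §4.13, proof of Lemma 4.13.1, pp. 64–66] -/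
theorem submatrix_smul_reindex_eq_boxAd_of_forall_eq {ι : Type*} (eI : {i : n // c i = false} ≃ ι) :
    (((((m true)⁻¹ : GL {j : n // c j = true} R) : Matrix {j : n // c j = true} {j : n // c j = true} R) j₀ j₀) •
          Matrix.reindex eI eI ((m false : GL {i : n // c i = false} R) : Matrix {i : n // c i = false} {i : n // c i = false} R)).submatrix
        (fun q : {i : n // c i = false} × {j : n // c j = true} => eI q.1) (fun q => eI q.1) =
      Matrix.of fun q q' : {i : n // c i = false} × {j : n // c j = true} =>
        (((leviEmbeddingP R c m : standardParabolicGL R c) : GL n R) : Matrix n n R) q.1 q'.1 *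
          ((((leviEmbeddingP R c m)⁻¹ : standardParabolicGL R c) : GL n R) : Matrix n n R) q'.2 q.2 := by
  ext q q'
  rw [boxAd_leviEmbeddingP_apply_of_forall_eq m j₀ hj₀, Matrix.submatrix_apply, Matrix.smul_apply, Matrix.reindex_apply, Matrix.submatrix_apply,
    Equiv.symm_apply_apply, Equiv.symm_apply_apply, smul_eq_mul]

omit [Fintype n] [DecidableEq n] in
include hj₀ in
/-- The projection `q ↦ eI q.1` is a bijection `I × {j₀} ≃ ι` (used to transport determinants). [folklore] -/
private theorem bijective_fst_of_forall_eq {ι : Type*} (eI : {i : n // c i = false} ≃ ι) :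
    Function.Bijective (fun q : {i : n // c i = false} × {j : n // c j = true} => eI q.1) := by
  refine ⟨fun q q' h => Prod.ext (eI.injective h) ((hj₀ q.2).trans (hj₀ q'.2).symm), fun i => ⟨(eI.symm i, j₀), eI.apply_symm_apply i⟩⟩

include hj₀ in
/-- **`det K_p = det(t⁻¹ • g)`** for `p = diag(m false, m true)`, `J = {j₀}`, `g = reindex eI eI (m false)`, `t⁻¹ = ((m true)⁻¹)_{j₀j₀}` — the modulus character side
(`δ_P(p) = ‖det K_p‖`). [cite: Rogawski1990, §4.13, proof of Lemma 4.13.1, pp. 64–66] -/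
theorem det_boxAd_leviEmbeddingP_of_forall_eq {ι : Type*} [Fintype ι] [DecidableEq ι] (eI : {i : n // c i = false} ≃ ι) :
    (Matrix.of fun q q' : {i : n // c i = false} × {j : n // c j = true} =>
        (((leviEmbeddingP R c m : standardParabolicGL R c) : GL n R) : Matrix n n R) q.1 q'.1 *
          ((((leviEmbeddingP R c m)⁻¹ : standardParabolicGL R c) : GL n R) : Matrix n n R) q'.2 q.2).det =
      (((((m true)⁻¹ : GL {j : n // c j = true} R) : Matrix {j : n // c j = true} {j : n // c j = true} R) j₀ j₀) •
          Matrix.reindex eI eI ((m false : GL {i : n // c i = false} R) : Matrix {i : n // c i = false} {i : n // c i = false} R)).det := by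
  rw [← submatrix_smul_reindex_eq_boxAd_of_forall_eq m j₀ hj₀ eI]
  exact Matrix.det_submatrix_equiv_self (R := R) (Equiv.ofBijective _ (bijective_fst_of_forall_eq j₀ hj₀ eI))
    (((((m true)⁻¹ : GL {j : n // c j = true} R) : Matrix {j : n // c j = true} {j : n // c j = true} R) j₀ j₀) •
          Matrix.reindex eI eI ((m false : GL {i : n // c i = false} R) : Matrix {i : n // c i = false} {i : n // c i = false} R))

include hj₀ in
/-- **`det(1 − K_p) = det(1 − t⁻¹ • g)`** for `p = diag(m false, m true)`, `J = {j₀}` — the Weyl-discriminant side (`|D_{G∕M}(p)| = ‖det(1 − K_p)‖² ‖det K_p‖⁻¹`).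
[cite: Rogawski1990, §4.13, proof of Lemma 4.13.1, pp. 64–66] -/
theorem det_one_sub_boxAd_leviEmbeddingP_of_forall_eq {ι : Type*} [Fintype ι] [DecidableEq ι] (eI : {i : n // c i = false} ≃ ι) :
    (1 - Matrix.of fun q q' : {i : n // c i = false} × {j : n // c j = true} =>
        (((leviEmbeddingP R c m : standardParabolicGL R c) : GL n R) : Matrix n n R) q.1 q'.1 *
          ((((leviEmbeddingP R c m)⁻¹ : standardParabolicGL R c) : GL n R) : Matrix n n R) q'.2 q.2).det =
      (1 - ((((m true)⁻¹ : GL {j : n // c j = true} R) : Matrix {j : n // c j = true} {j : n // c j = true} R) j₀ j₀) •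
          Matrix.reindex eI eI ((m false : GL {i : n // c i = false} R) : Matrix {i : n // c i = false} {i : n // c i = false} R)).det := by
  have hbox : (Matrix.of fun q q' : {i : n // c i = false} × {j : n // c j = true} =>
        (((leviEmbeddingP R c m : standardParabolicGL R c) : GL n R) : Matrix n n R) q.1 q'.1 *
          ((((leviEmbeddingP R c m)⁻¹ : standardParabolicGL R c) : GL n R) : Matrix n n R) q'.2 q.2) =
      (((((m true)⁻¹ : GL {j : n // c j = true} R) : Matrix {j : n // c j = true} {j : n // c j = true} R) j₀ j₀) •
          Matrix.reindex eI eI ((m false : GL {i : n // c i = false} R) : Matrix {i : n // c i = false} {i : n // c i = false} R)).submatrix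
        (Equiv.ofBijective _ (bijective_fst_of_forall_eq j₀ hj₀ eI)) (Equiv.ofBijective _ (bijective_fst_of_forall_eq j₀ hj₀ eI)) :=
    (submatrix_smul_reindex_eq_boxAd_of_forall_eq m j₀ hj₀ eI).symm
  rw [hbox, ← Matrix.submatrix_one_equiv (Equiv.ofBijective _ (bijective_fst_of_forall_eq j₀ hj₀ eI))]
  exact Matrix.det_submatrix_equiv_self (R := R) (Equiv.ofBijective _ (bijective_fst_of_forall_eq j₀ hj₀ eI))
    (1 - ((((m true)⁻¹ : GL {j : n // c j = true} R) : Matrix {j : n // c j = true} {j : n // c j = true} R) j₀ j₀) •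
          Matrix.reindex eI eI ((m false : GL {i : n // c i = false} R) : Matrix {i : n // c i = false} {i : n // c i = false} R))

omit m in
/-- A block-diagonal element of `P_c` (`(p : GL_n) ∈ M_c`) IS `diag(m_a)_a` for some block family `m` — so every head above applies to D-N7s's `p` after
`obtain ⟨m, rfl⟩`. [cite: BernsteinZelevinsky1977, §2.1] -/
theorem exists_eq_leviEmbeddingP_of_mem_standardLeviGL {α : Type*} [LinearOrder α] [Fintype α] {c : n → α} {p : standardParabolicGL R c}
    (hp : (p : GL n R) ∈ standardLeviGL R c) : ∃ m : Π a, GL {i // c i = a} R, p = leviEmbeddingP R c m := by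
  obtain ⟨m, hm⟩ := hp
  exact ⟨m, Subtype.ext hm.symm⟩

end TwoBlock

end Literature.NumberTheory.Automorphic

/-! ## §2 The split place: `finWeylRatio = ‖det(1 − K_p)‖ · ‖det K_p‖^{−1∕2}` in the D-S1 box -/

namespace Literature.NumberTheory.Rogawski1990

open NumberField IsDedekindDomain
open Literature.NumberTheory.Automorphic

variable (L : Type) [Field L] [NumberField L] [IsCMField L] (v : HeightOneSpectrum (𝓞 ↥(maximalRealSubfield L)))
  (a : (UnitaryGroup.cmDatum L 2 (Matrix.of fun i j : Fin 2 => if i.val + j.val + 1 = 2 then (1 : L) else 0)).Local v ×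
      (UnitaryGroup.cmDatum L 1 (Matrix.of fun i j : Fin 1 => if i.val + j.val + 1 = 1 then (1 : L) else 0)).Local v)
  (w : UnitaryGroup.PlacesOver L v)
  {n : Type*} [Fintype n] [DecidableEq n] {c' : n → Bool} (m : Π b, GL {i // c' i = b} (w.1.adicCompletion L))
  (eI : {i : n // c' i = false} ≃ Fin 2) (j₀ : {j : n // c' j = true}) (hj₀ : ∀ j : {j : n // c' j = true}, j = j₀)

include hj₀ in
/-- **THE TWO `|D_{G∕M}|^{1∕2}` PRESENTATIONS ARE EQUAL AT A SPLIT PLACE.**  For `γ_H = (g, u) ∈ H_v` at a place `v` split in `L` (`w ∣ v`, `c • w ≠ w`) and ANY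
two-block Levi element `p = diag(m false, m true) ∈ P_{c′} ⊂ GL_n(L_w)` whose first block is `g_w` up to the relabelling `eI : {c′ = false} ≃ Fin 2` and whose second
block is the `1 × 1` matrix `(u_w)` (`J = {j₀}`): Rogawski's `D_{G∕H,v}(γ_H)` (★ `finWeylRatio`, ★ `finWeylRatio_eq_box_of_split`: `= ‖det(1 − u_w⁻¹ g_w)‖ ‖det(u_w⁻¹ g_w)‖^{−1∕2}`)
equals `‖det(1 − K_p)‖_w · ‖det K_p‖_w^{−1∕2}` in the D-S1 box `K_p = Matrix.of (p q.1 q′.1 * p⁻¹ q′.2 q.2)` of ★ `GLnTwoBlockUnipotentConjugation` ∕ ★ `GLnBlockScalarOrbitalIntegral`.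
[cite: Rogawski1990, §4.9 p. 55; §4.13, Lemma 4.13.1 p. 64] -/
theorem finWeylRatio_eq_boxAd_of_split (hw : IsCMField.complexConj L • w.1 ≠ w.1)
    (hg : Matrix.reindex eI eI ((m false : GL {i : n // c' i = false} (w.1.adicCompletion L)) : Matrix _ _ (w.1.adicCompletion L)) =
      (a.1.val.val : Matrix (Fin 2) (Fin 2) (UnitaryGroup.LocalRing L v)).map (fun x => x w))
    (ht : ((m true : GL {j : n // c' j = true} (w.1.adicCompletion L)) : Matrix _ _ (w.1.adicCompletion L)) j₀ j₀ = finGammaTwo L v a w) :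
    finWeylRatio L v a =
      ‖(1 - Matrix.of fun q q' : {i : n // c' i = false} × {j : n // c' j = true} =>
          (((leviEmbeddingP (w.1.adicCompletion L) c' m : standardParabolicGL (w.1.adicCompletion L) c') : GL n (w.1.adicCompletion L)) :
              Matrix n n (w.1.adicCompletion L)) q.1 q'.1 *
            ((((leviEmbeddingP (w.1.adicCompletion L) c' m)⁻¹ : standardParabolicGL (w.1.adicCompletion L) c') : GL n (w.1.adicCompletion L)) :
              Matrix n n (w.1.adicCompletion L)) q'.2 q.2).det‖ *
        (Real.sqrt ‖(Matrix.of fun q q' : {i : n // c' i = false} × {j : n // c' j = true} =>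
          (((leviEmbeddingP (w.1.adicCompletion L) c' m : standardParabolicGL (w.1.adicCompletion L) c') : GL n (w.1.adicCompletion L)) :
              Matrix n n (w.1.adicCompletion L)) q.1 q'.1 *
            ((((leviEmbeddingP (w.1.adicCompletion L) c' m)⁻¹ : standardParabolicGL (w.1.adicCompletion L) c') : GL n (w.1.adicCompletion L)) :
              Matrix n n (w.1.adicCompletion L)) q'.2 q.2).det‖)⁻¹ := by
  have hinv : (((m true)⁻¹ : GL {j : n // c' j = true} (w.1.adicCompletion L)) : Matrix _ _ (w.1.adicCompletion L)) j₀ j₀ = (finGammaTwo L v a w)⁻¹ := by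
    rw [GeneralLinearGroup.inv_apply_of_forall_eq (m true) j₀ hj₀, ht]
  rw [det_boxAd_leviEmbeddingP_of_forall_eq m j₀ hj₀ eI, det_one_sub_boxAd_leviEmbeddingP_of_forall_eq m j₀ hj₀ eI, hinv, hg]
  exact finWeylRatio_eq_box_of_split L v a w hw

omit m eI j₀ hj₀ in
/-- **The block-scalar point** (★ `boxAd_leviEmbeddingP_scalar`: `K_z = (t₁∕t₂) • 1`): if `g_w = t₁ • 1` and `u_w = t₂` (print's singular `(G,H)`-regular `γ_H` with
`γ₁ = γ₃ = t₁`, `γ₂ = t₂` at `w`), then `D_{G∕H,v}(γ_H) = ‖1 − t₁t₂⁻¹‖_w² · ‖t₁t₂⁻¹‖_w⁻¹` (`|I| = 2`: `det(1 − s•1) = (1 − s)²`, `det(s•1) = s²`).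
[cite: Rogawski1990, §4.9 p. 55; §4.13 p. 64] -/
theorem finWeylRatio_eq_of_split_of_scalar (hw : IsCMField.complexConj L • w.1 ≠ w.1) (t₁ t₂ : (w.1.adicCompletion L)ˣ)
    (hg : (a.1.val.val : Matrix (Fin 2) (Fin 2) (UnitaryGroup.LocalRing L v)).map (fun x => x w) = (t₁ : w.1.adicCompletion L) • (1 : Matrix (Fin 2) (Fin 2) _))
    (ht : finGammaTwo L v a w = t₂) :
    finWeylRatio L v a = ‖1 - (t₁ : w.1.adicCompletion L) * (t₂ : w.1.adicCompletion L)⁻¹‖ ^ 2 * ‖(t₁ : w.1.adicCompletion L) * (t₂ : w.1.adicCompletion L)⁻¹‖⁻¹ := by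
  rw [finWeylRatio_eq_box_of_split L v a w hw, hg, ht, smul_smul, ← mul_comm (t₁ : w.1.adicCompletion L)]
  have h1 : (1 : Matrix (Fin 2) (Fin 2) (w.1.adicCompletion L)) - ((t₁ : w.1.adicCompletion L) * (t₂ : w.1.adicCompletion L)⁻¹) • (1 : Matrix (Fin 2) (Fin 2) _) =
      (1 - (t₁ : w.1.adicCompletion L) * (t₂ : w.1.adicCompletion L)⁻¹) • (1 : Matrix (Fin 2) (Fin 2) _) := by
    rw [sub_smul, one_smul]
  rw [h1, Matrix.det_smul, Matrix.det_smul, Matrix.det_one, mul_one, mul_one, Fintype.card_fin, norm_pow, norm_pow, Real.sqrt_sq (norm_nonneg _)]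

end Literature.NumberTheory.Rogawski1990

end
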